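import Mathlib
import Summits.Ventures.PercRepro2.Defs
import Summits.Ventures.PercRepro2.Independence
import Summits.Ventures.PercRepro2.Harris
import Summits.Ventures.PercRepro2.Graph
import Summits.Ventures.PercRepro2.Events
import Summits.Ventures.PercRepro2.Induced
import Summits.Ventures.PercRepro2.ObsIndependence
import Summits.Ventures.PercRepro2.VdBKahn
import Summits.Ventures.PercRepro2.BHK
import Summits.Ventures.PercRepro2.BHKEvents
import Summits.Ventures.PercRepro2.BHKPair
import Summits.Ventures.PercRepro2.BHKAntitone
import Summits.Ventures.PercRepro2.BHKFibre
import Summits.Ventures.PercRepro2.BlockConn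
import Summits.Ventures.PercRepro2.ContractedCluster
import Summits.Ventures.PercRepro2.BHKContracted

/-!
# The fibre-event corollary of the contracted antitone BHK inequality
(blind cell PercRepro2, mine-1 g53; paper proofs/MINE1-BLOCKS.md §2.5(d))

`BHKFibre.bhk_fibre_four` bounds products of probabilities of events
`{C_t ∈ 𝓤} ∩ {G ∖ C_t ∈ A ∩ B} ∩ {t ↮ X}` through the exploration of the plain cluster `C_t`.
This file is the same corollary for the CONTRACTED cluster `C^𝒲_t` of a block family `𝒲`
(`clusterB`), explored in the whole graph: its level sets are determined by the edges touching
it (`dependsOn_clusterBEvent`), so the tower identity gives the exploration identity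
`prob_clusterB_inter_fibre_avoid_eq_expect`, and `bhk_antitone_contracted` closes the
four-functions step:

  `P(C^𝒲_t ∈ 𝓤₁, G∖C^𝒲_t ∈ A₁∩B₁, t ↮_𝒲 X) · P(C^𝒲_t ∈ 𝓤₂, G∖C^𝒲_t ∈ A₂∩B₂, t ↮_𝒲 Y)
     ≤ P(C^𝒲_t ∈ 𝓤₁∩𝓤₂, G∖C^𝒲_t ∈ B₁∩B₂, t ↮_𝒲 X∩Y) · P(G∖C^𝒲_t ∈ A₁∩A₂, t ↮_𝒲 X∪Y)`

(`bhk_fibre_four_contracted`) — the base-case tool of the block family with blocks on both sides.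
-/

namespace Summit.Ventures.PercRepro2

namespace BlockFamily

open BHKFibre

section ClusterB

variable {V : Type*} {E : Type*} {ends : E → Sym2 V} {𝒲 : Finset (Finset V)} {t : V}

/-- The contracted cluster of `t` in the whole graph. -/
def clusterB (ends : E → Sym2 V) (ω : Config E) (𝒲 : Finset (Finset V)) (t : V) : Set V :=
  {x | ConnB ends ω 𝒲 t x}

/-- Membership in the contracted cluster. -/
@[simp] lemma mem_clusterB {ω : Config E} {x : V} :
    x ∈ clusterB ends ω 𝒲 t ↔ ConnB ends ω 𝒲 t x := Iff.rfl

/-- The avoidance event `{t ↮_𝒲 x for all x ∈ X}` in the whole graph. -/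
def avoidAllB (ends : E → Sym2 V) (𝒲 : Finset (Finset V)) (t : V) (X : Finset V) :
    Set (Config E) :=
  {ω | ∀ x ∈ X, ¬ ConnB ends ω 𝒲 t x}

/-- The fibre event: the configuration with the edges touching the contracted cluster of `t`
closed lies in `A`. -/
def fibreEventB (ends : E → Sym2 V) (𝒲 : Finset (Finset V)) (t : V) (A : Set (Config E)) :
    Set (Config E) :=
  {ω | delConfig ends (clusterB ends ω 𝒲 t) ω ∈ A}

/-- The contracted cluster contains `t`. -/
lemma mem_clusterB_self (ω : Config E) : t ∈ clusterB ends ω 𝒲 t := connB_refl t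

/-- The plain cluster of a vertex of the contracted cluster lies in the contracted cluster. -/
lemma cluster_subset_clusterB {ω : Config E} {a : V} (ha : a ∈ clusterB ends ω 𝒲 t) :
    cluster ends ω a ⊆ clusterB ends ω 𝒲 t :=
  fun _ hx => connB_trans ha (connB_of_conn hx)

/-- The level set `{C^𝒲_t = S}` is determined by the edges touching `S`. -/
lemma clusterB_eq_of_eqOn_touches {ω ω' : Config E} {S : Set V}
    (h : ∀ e ∈ touches ends S, ω e = ω' e) (hS : clusterB ends ω 𝒲 t = S) :
    clusterB ends ω' 𝒲 t = S := by
  -- a plain cluster inside `S` is the same in `ω` and `ω'`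
  have hcl : ∀ a ∈ S, cluster ends ω' a = cluster ends ω a := by
    intro a ha
    have hsub : cluster ends ω a ⊆ S := hS ▸ cluster_subset_clusterB (hS ▸ ha)
    exact cluster_eq_of_eqOn_touches (fun e he => h e (touches_mono hsub he)) rfl
  apply Set.Subset.antisymm
  · -- `C^𝒲_t(ω') ⊆ S`
    intro u hu
    have key : u ∈ S ∧ ConnB ends ω 𝒲 t u := by
      refine connB_induction (P := fun y => y ∈ S ∧ ConnB ends ω 𝒲 t y)
        ⟨hS ▸ mem_clusterB_self ω, connB_refl t⟩ ?_ hu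
      rintro b y _ ⟨hbS, hb⟩ hby
      rcases hby with hby | ⟨B, hB, hbB, hyB⟩
      · have hy : y ∈ cluster ends ω b := by rw [← hcl b hbS]; exact hby
        exact ⟨hS ▸ cluster_subset_clusterB (hS ▸ hbS) hy, connB_trans hb (connB_of_conn hy)⟩
      · have hy : ConnB ends ω 𝒲 t y := connB_trans hb (connB_of_mem_block hB hbB hyB)
        exact ⟨hS ▸ hy, hy⟩
    exact key.1
  · -- `S ⊆ C^𝒲_t(ω')`
    intro u hu
    rw [← hS] at hu
    refine connB_induction (P := fun y => ConnB ends ω' 𝒲 t y) (connB_refl t) ?_ hu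
    rintro b y hb _ hby
    have hbS : b ∈ S := hS ▸ hb
    have ih : ConnB ends ω' 𝒲 t b := by
      refine connB_induction (P := fun y => ConnB ends ω' 𝒲 t y) (connB_refl t) ?_ hb
      rintro c y hc hc' hcy
      rcases hcy with hcy | ⟨B, hB, hcB, hyB⟩
      · have hy : y ∈ cluster ends ω' c := by rw [hcl c (hS ▸ hc)]; exact hcy
        exact connB_trans hc' (connB_of_conn hy)
      · exact connB_trans hc' (connB_of_mem_block hB hcB hyB)
    rcases hby with hby | ⟨B, hB, hbB, hyB⟩
    · have hy : y ∈ cluster ends ω' b := by rw [hcl b hbS]; exact hby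
      exact connB_trans ih (connB_of_conn hy)
    · exact connB_trans ih (connB_of_mem_block hB hbB hyB)

/-- **Domain Markov property for the contracted cluster**: `{C^𝒲_t = S}` is determined by the
edges touching `S`. -/
theorem dependsOn_clusterBEvent (S : Set V) :
    DependsOn (· ∈ {ω : Config E | clusterB ends ω 𝒲 t = S}) (touches ends S) := by
  intro ω ω' h
  exact propext ⟨clusterB_eq_of_eqOn_touches h,
    clusterB_eq_of_eqOn_touches fun e he => (h e he).symm⟩

end ClusterB

section Univ

variable {V : Type*} {E : Type*} [Fintype V] [DecidableEq V] {ends : E → Sym2 V}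
  {𝒲 : Finset (Finset V)} {t : V}

/-- The blocks cut down to all vertices are the blocks. -/
lemma blocksIn_univ : blocksIn 𝒲 Finset.univ = 𝒲 := by
  simp [blocksIn]

/-- On the full vertex set the contracted cluster of `G[U]` is the whole-graph one. -/
lemma clusterInB_univ (ω : Config E) : clusterInB ends Finset.univ 𝒲 t ω = clusterB ends ω 𝒲 t := by
  ext x
  simp only [mem_clusterInB, mem_clusterB, Finset.coe_univ, induced_univ, blocksIn_univ]

/-- On the full vertex set `REventB` is `avoidAllB`. -/
lemma REventB_univ (X : Finset V) : REventB ends Finset.univ 𝒲 t X = avoidAllB ends 𝒲 t X := by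
  ext ω
  simp only [mem_REventB, avoidAllB, Set.mem_setOf_eq, Finset.coe_univ, induced_univ, blocksIn_univ]

end Univ

section Exploration

variable {V : Type*} {E : Type*} [Fintype E] [DecidableEq E] [Fintype V] {R : Type*} [CommRing R]

/-- **Exploring the contracted cluster of `t`, fibre form**:
`P(C^𝒲_t ∈ 𝓤, G ∖ C^𝒲_t ∈ A, t ↮_𝒲 X) = E[1_𝓤(C^𝒲_t) · g_A(C^𝒲_t) · 1_{t ↮_𝒲 X}]`. -/
theorem prob_clusterB_inter_fibre_avoid_eq_expect (p : E → R) (ends : E → Sym2 V)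
    (𝒲 : Finset (Finset V)) (t : V) (X : Finset V) (𝓤 : Set (Set V)) (A : Set (Config E)) :
    prob p ({ω | clusterB ends ω 𝒲 t ∈ 𝓤} ∩ fibreEventB ends 𝒲 t A ∩ avoidAllB ends 𝒲 t X) =
      expect p (fun ω => 𝓤.indicator 1 (clusterB ends ω 𝒲 t) *
        delEventProb p ends A (clusterB ends ω 𝒲 t) * (avoidAllB ends 𝒲 t X).indicator 1 ω) := by
  classical
  let 𝓐 : Set (Set V) := {W | ∀ x ∈ X, x ∉ W}
  have hA : ∀ ω, ω ∈ avoidAllB ends 𝒲 t X ↔ clusterB ends ω 𝒲 t ∈ 𝓐 := fun ω => Iff.rfl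
  let c : Set V → R := fun W => 𝓤.indicator 1 W * 𝓐.indicator 1 W
  let D : Set V → Config E → R := fun W =>
    ({ω | delConfig ends W ω ∈ A} : Set (Config E)).indicator 1
  let Φ : Set V → Config E → R := fun W ω => c W * D W ω
  have hΦ : ∀ W, DependsOn (Φ W) (touches ends W)ᶜ := by
    intro W ω ω' h
    simp only [Φ, D]
    congr 1
    refine dependsOn_indicator (R := R) (fun ω ω' h => ?_) h
    show (delConfig ends W ω ∈ A) = (delConfig ends W ω' ∈ A)
    rw [delConfig_congr h]
  have hS : ∀ W : Set V, DependsOn (· ∈ {ω | clusterB ends ω 𝒲 t = W}) (touches ends W) :=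
    fun W => dependsOn_clusterBEvent W
  have hdisj : ∀ W : Set V, Disjoint (touches ends W) (touches ends W)ᶜ :=
    fun W => disjoint_compl_right
  have hpt : ∀ ω, ({ω | clusterB ends ω 𝒲 t ∈ 𝓤} ∩ fibreEventB ends 𝒲 t A ∩
      avoidAllB ends 𝒲 t X).indicator (1 : Config E → R) ω = Φ (clusterB ends ω 𝒲 t) ω := by
    intro ω
    simp only [Φ, c, D]
    have hmem : ω ∈ {ω' | delConfig ends (clusterB ends ω 𝒲 t) ω' ∈ A} ↔
        ω ∈ fibreEventB ends 𝒲 t A := Iff.rfl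
    by_cases hav : ω ∈ avoidAllB ends 𝒲 t X
    · rw [Set.indicator_of_mem (show clusterB ends ω 𝒲 t ∈ 𝓐 from (hA ω).1 hav)]
      by_cases h𝓤 : clusterB ends ω 𝒲 t ∈ 𝓤
      · rw [Set.indicator_of_mem h𝓤]
        by_cases hF : ω ∈ fibreEventB ends 𝒲 t A
        · rw [Set.indicator_of_mem (show ω ∈ {ω | clusterB ends ω 𝒲 t ∈ 𝓤} ∩
              fibreEventB ends 𝒲 t A ∩ avoidAllB ends 𝒲 t X from ⟨⟨h𝓤, hF⟩, hav⟩),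
            Set.indicator_of_mem (hmem.2 hF)]
          simp
        · rw [Set.indicator_of_notMem (show ω ∉ {ω | clusterB ends ω 𝒲 t ∈ 𝓤} ∩
              fibreEventB ends 𝒲 t A ∩ avoidAllB ends 𝒲 t X from fun h => hF h.1.2),
            Set.indicator_of_notMem (fun h => hF (hmem.1 h))]
          simp
      · rw [Set.indicator_of_notMem (show ω ∉ {ω | clusterB ends ω 𝒲 t ∈ 𝓤} ∩
            fibreEventB ends 𝒲 t A ∩ avoidAllB ends 𝒲 t X from fun h => h𝓤 h.1.1),
          Set.indicator_of_notMem h𝓤]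
        simp
    · rw [Set.indicator_of_notMem (show ω ∉ {ω | clusterB ends ω 𝒲 t ∈ 𝓤} ∩
          fibreEventB ends 𝒲 t A ∩ avoidAllB ends 𝒲 t X from fun h => hav h.2),
        Set.indicator_of_notMem (show clusterB ends ω 𝒲 t ∉ 𝓐 from fun h => hav ((hA ω).2 h))]
      simp
  have hΦexp : ∀ W, expect p (Φ W) = c W * delEventProb p ends A W := by
    intro W
    simp only [Φ, D]
    rw [expect_const_mul, ← prob_eq_expect_indicator]
    rfl
  rw [prob_eq_expect_indicator]
  have e1 : ({ω | clusterB ends ω 𝒲 t ∈ 𝓤} ∩ fibreEventB ends 𝒲 t A ∩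
      avoidAllB ends 𝒲 t X).indicator (1 : Config E → R) = fun ω => Φ (clusterB ends ω 𝒲 t) ω :=
    funext hpt
  rw [e1, expect_tower p hdisj (S := fun ω => clusterB ends ω 𝒲 t) hS hΦ]
  simp only [hΦexp]
  unfold expect
  refine Finset.sum_congr rfl fun ω _ => ?_
  simp only [c]
  by_cases hav : ω ∈ avoidAllB ends 𝒲 t X
  · rw [Set.indicator_of_mem (show clusterB ends ω 𝒲 t ∈ 𝓐 from (hA ω).1 hav),
      Set.indicator_of_mem hav]
    simp
  · rw [Set.indicator_of_notMem (show clusterB ends ω 𝒲 t ∉ 𝓐 from fun h => hav ((hA ω).2 h)),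
      Set.indicator_of_notMem hav]
    simp

end Exploration

section Four

variable {V : Type*} {E : Type*} [Fintype E] [DecidableEq E] [Fintype V] [DecidableEq V]
  {R : Type*} [CommRing R] [LinearOrder R] [IsStrictOrderedRing R]

/-- **The two-cluster four-functions inequality with fibre events for the CONTRACTED cluster**:
for a block family `𝒲`, up-sets `𝓤₁, 𝓤₂` of the contracted cluster `C^𝒲_t`, up-sets `A₁, A₂` and
down-sets `B₁, B₂` of the fibre `G ∖ C^𝒲_t`, and avoided sets `X, Y`,
`P(C^𝒲_t ∈ 𝓤₁, G∖C^𝒲_t ∈ A₁∩B₁, t↮_𝒲 X) · P(C^𝒲_t ∈ 𝓤₂, G∖C^𝒲_t ∈ A₂∩B₂, t↮_𝒲 Y)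
  ≤ P(C^𝒲_t ∈ 𝓤₁∩𝓤₂, G∖C^𝒲_t ∈ B₁∩B₂, t↮_𝒲 X∩Y) · P(G∖C^𝒲_t ∈ A₁∩A₂, t↮_𝒲 X∪Y)`. -/
theorem bhk_fibre_four_contracted (p : E → R) (hp : IsProbVec p) (ends : E → Sym2 V)
    (𝒲 : Finset (Finset V)) (t : V) (X Y : Finset V) {𝓤₁ 𝓤₂ : Set (Set V)}
    (h𝓤₁ : IsUpperSet 𝓤₁) (h𝓤₂ : IsUpperSet 𝓤₂) {A₁ A₂ B₁ B₂ : Set (Config E)}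
    (hA₁ : IsUpperSet A₁) (hA₂ : IsUpperSet A₂) (hB₁ : IsLowerSet B₁) (hB₂ : IsLowerSet B₂) :
    prob p ({ω | clusterB ends ω 𝒲 t ∈ 𝓤₁} ∩ fibreEventB ends 𝒲 t (A₁ ∩ B₁) ∩
        avoidAllB ends 𝒲 t X) *
      prob p ({ω | clusterB ends ω 𝒲 t ∈ 𝓤₂} ∩ fibreEventB ends 𝒲 t (A₂ ∩ B₂) ∩
        avoidAllB ends 𝒲 t Y) ≤
      prob p ({ω | clusterB ends ω 𝒲 t ∈ 𝓤₁ ∩ 𝓤₂} ∩ fibreEventB ends 𝒲 t (B₁ ∩ B₂) ∩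
          avoidAllB ends 𝒲 t (X ∩ Y)) *
        prob p (fibreEventB ends 𝒲 t (A₁ ∩ A₂) ∩ avoidAllB ends 𝒲 t (X ∪ Y)) := by
  classical
  have e1 := prob_clusterB_inter_fibre_avoid_eq_expect p ends 𝒲 t X 𝓤₁ (A₁ ∩ B₁)
  have e2 := prob_clusterB_inter_fibre_avoid_eq_expect p ends 𝒲 t Y 𝓤₂ (A₂ ∩ B₂)
  have e3 := prob_clusterB_inter_fibre_avoid_eq_expect p ends 𝒲 t (X ∩ Y) (𝓤₁ ∩ 𝓤₂) (B₁ ∩ B₂)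
  have e4 := prob_clusterB_inter_fibre_avoid_eq_expect p ends 𝒲 t (X ∪ Y) Set.univ (A₁ ∩ A₂)
  simp only [Set.indicator_univ, Pi.one_apply, one_mul] at e4
  have e4' : {ω : Config E | clusterB ends ω 𝒲 t ∈ Set.univ} ∩ fibreEventB ends 𝒲 t (A₁ ∩ A₂) ∩
      avoidAllB ends 𝒲 t (X ∪ Y) = fibreEventB ends 𝒲 t (A₁ ∩ A₂) ∩ avoidAllB ends 𝒲 t (X ∪ Y) := by
    ext ω; simp
  rw [e4'] at e4
  have nI : ∀ (𝓤 : Set (Set V)) (W : Set V), 0 ≤ 𝓤.indicator (1 : Set V → R) W :=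
    fun 𝓤 W => Set.indicator_apply_nonneg fun _ => zero_le_one
  have nA : ∀ (A : Set (Config E)) (ω : Config E), 0 ≤ A.indicator (1 : Config E → R) ω :=
    fun A ω => Set.indicator_apply_nonneg fun _ => zero_le_one
  have mW₁ := delEventProb_mono p hp ends hB₁
  have mW₂ := delEventProb_mono p hp ends hB₂
  have hF₁ : Monotone (𝓤₁.indicator (1 : Set V → R) * delEventProb p ends B₁) := by
    intro W W' h
    simp only [Pi.mul_apply]
    exact mul_le_mul (monotone_indicator_one_of_isUpperSet h𝓤₁ h) (mW₁ h)
      (delEventProb_nonneg p hp ends B₁ W) (nI 𝓤₁ W')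
  have hF₂ : Monotone (𝓤₂.indicator (1 : Set V → R) * delEventProb p ends B₂) := by
    intro W W' h
    simp only [Pi.mul_apply]
    exact mul_le_mul (monotone_indicator_one_of_isUpperSet h𝓤₂ h) (mW₂ h)
      (delEventProb_nonneg p hp ends B₂ W) (nI 𝓤₂ W')
  have hD₁ : Antitone (delEventProb p ends A₁) := delEventProb_anti p hp ends hA₁
  have hD₂ : Antitone (delEventProb p ends A₂) := delEventProb_anti p hp ends hA₂
  have hF₁0 : ∀ W, 0 ≤ (𝓤₁.indicator (1 : Set V → R) * delEventProb p ends B₁) W :=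
    fun W => mul_nonneg (nI 𝓤₁ W) (delEventProb_nonneg p hp ends B₁ W)
  have hF₂0 : ∀ W, 0 ≤ (𝓤₂.indicator (1 : Set V → R) * delEventProb p ends B₂) W :=
    fun W => mul_nonneg (nI 𝓤₂ W) (delEventProb_nonneg p hp ends B₂ W)
  have hD₁0 : ∀ W, 0 ≤ delEventProb p ends A₁ W := delEventProb_nonneg p hp ends A₁
  have hD₂0 : ∀ W, 0 ≤ delEventProb p ends A₂ W := delEventProb_nonneg p hp ends A₂
  have key := bhk_antitone_contracted p hp ends 𝒲 t hF₁ hF₂ hD₁ hD₂ hF₁0 hF₂0 hD₁0 hD₂0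
    Finset.univ X Y (Finset.subset_univ _) (Finset.subset_univ _)
  simp only [REventB_univ] at key
  have e : ∀ (F : Set V → R) (A : Set (Config E)),
      clusterObsB ends Finset.univ 𝒲 t F * A.indicator 1 =
        fun ω => F (clusterB ends ω 𝒲 t) * A.indicator 1 ω := by
    intro F A
    funext ω
    simp only [Pi.mul_apply, clusterObsB_apply, clusterInB_univ]
  rw [e, e, e, e] at key
  simp only [Pi.mul_apply] at key
  have eL₁ : prob p ({ω | clusterB ends ω 𝒲 t ∈ 𝓤₁} ∩ fibreEventB ends 𝒲 t (A₁ ∩ B₁) ∩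
      avoidAllB ends 𝒲 t X) ≤ expect p (fun ω => 𝓤₁.indicator (1 : Set V → R) (clusterB ends ω 𝒲 t) *
        delEventProb p ends B₁ (clusterB ends ω 𝒲 t) *
        delEventProb p ends A₁ (clusterB ends ω 𝒲 t) * (avoidAllB ends 𝒲 t X).indicator 1 ω) := by
    rw [e1]
    refine expect_mono hp fun ω => ?_
    refine mul_le_mul_of_nonneg_right ?_ (nA _ ω)
    calc 𝓤₁.indicator (1 : Set V → R) (clusterB ends ω 𝒲 t) *
          delEventProb p ends (A₁ ∩ B₁) (clusterB ends ω 𝒲 t)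
        ≤ 𝓤₁.indicator (1 : Set V → R) (clusterB ends ω 𝒲 t) *
          (delEventProb p ends A₁ (clusterB ends ω 𝒲 t) *
            delEventProb p ends B₁ (clusterB ends ω 𝒲 t)) :=
          mul_le_mul_of_nonneg_left (delEventProb_inter_le_mul p hp ends hA₁ hB₁ _) (nI _ _)
      _ = _ := by ring
  have eL₂ : prob p ({ω | clusterB ends ω 𝒲 t ∈ 𝓤₂} ∩ fibreEventB ends 𝒲 t (A₂ ∩ B₂) ∩
      avoidAllB ends 𝒲 t Y) ≤ expect p (fun ω => 𝓤₂.indicator (1 : Set V → R) (clusterB ends ω 𝒲 t) *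
        delEventProb p ends B₂ (clusterB ends ω 𝒲 t) *
        delEventProb p ends A₂ (clusterB ends ω 𝒲 t) * (avoidAllB ends 𝒲 t Y).indicator 1 ω) := by
    rw [e2]
    refine expect_mono hp fun ω => ?_
    refine mul_le_mul_of_nonneg_right ?_ (nA _ ω)
    calc 𝓤₂.indicator (1 : Set V → R) (clusterB ends ω 𝒲 t) *
          delEventProb p ends (A₂ ∩ B₂) (clusterB ends ω 𝒲 t)
        ≤ 𝓤₂.indicator (1 : Set V → R) (clusterB ends ω 𝒲 t) *
          (delEventProb p ends A₂ (clusterB ends ω 𝒲 t) *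
            delEventProb p ends B₂ (clusterB ends ω 𝒲 t)) :=
          mul_le_mul_of_nonneg_left (delEventProb_inter_le_mul p hp ends hA₂ hB₂ _) (nI _ _)
      _ = _ := by ring
  have eJ : expect p (fun ω => 𝓤₁.indicator (1 : Set V → R) (clusterB ends ω 𝒲 t) *
      delEventProb p ends B₁ (clusterB ends ω 𝒲 t) *
      (𝓤₂.indicator (1 : Set V → R) (clusterB ends ω 𝒲 t) *
        delEventProb p ends B₂ (clusterB ends ω 𝒲 t)) *
      (avoidAllB ends 𝒲 t (X ∩ Y)).indicator 1 ω) ≤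
      prob p ({ω | clusterB ends ω 𝒲 t ∈ 𝓤₁ ∩ 𝓤₂} ∩ fibreEventB ends 𝒲 t (B₁ ∩ B₂) ∩
        avoidAllB ends 𝒲 t (X ∩ Y)) := by
    rw [e3]
    refine expect_mono hp fun ω => ?_
    refine mul_le_mul_of_nonneg_right ?_ (nA _ ω)
    have hind : 𝓤₁.indicator (1 : Set V → R) (clusterB ends ω 𝒲 t) *
        𝓤₂.indicator (1 : Set V → R) (clusterB ends ω 𝒲 t) =
        (𝓤₁ ∩ 𝓤₂).indicator (1 : Set V → R) (clusterB ends ω 𝒲 t) := by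
      by_cases h1 : clusterB ends ω 𝒲 t ∈ 𝓤₁ <;> by_cases h2 : clusterB ends ω 𝒲 t ∈ 𝓤₂ <;>
        simp [h1, h2]
    calc 𝓤₁.indicator (1 : Set V → R) (clusterB ends ω 𝒲 t) *
          delEventProb p ends B₁ (clusterB ends ω 𝒲 t) *
          (𝓤₂.indicator (1 : Set V → R) (clusterB ends ω 𝒲 t) *
            delEventProb p ends B₂ (clusterB ends ω 𝒲 t))
        = (𝓤₁.indicator (1 : Set V → R) (clusterB ends ω 𝒲 t) *
            𝓤₂.indicator (1 : Set V → R) (clusterB ends ω 𝒲 t)) *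
          (delEventProb p ends B₁ (clusterB ends ω 𝒲 t) *
            delEventProb p ends B₂ (clusterB ends ω 𝒲 t)) := by ring
      _ ≤ (𝓤₁ ∩ 𝓤₂).indicator (1 : Set V → R) (clusterB ends ω 𝒲 t) *
          delEventProb p ends (B₁ ∩ B₂) (clusterB ends ω 𝒲 t) := by
          rw [hind]
          exact mul_le_mul_of_nonneg_left
            (delEventProb_mul_le_inter_of_isLowerSet p hp ends hB₁ hB₂ _) (nI _ _)
  have eM : expect p (fun ω => delEventProb p ends A₁ (clusterB ends ω 𝒲 t) *
      delEventProb p ends A₂ (clusterB ends ω 𝒲 t) * (avoidAllB ends 𝒲 t (X ∪ Y)).indicator 1 ω) ≤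
      prob p (fibreEventB ends 𝒲 t (A₁ ∩ A₂) ∩ avoidAllB ends 𝒲 t (X ∪ Y)) := by
    rw [e4]
    refine expect_mono hp fun ω => ?_
    exact mul_le_mul_of_nonneg_right (delEventProb_mul_le_inter p hp ends hA₁ hA₂ _) (nA _ ω)
  have nL₂ : 0 ≤ prob p ({ω | clusterB ends ω 𝒲 t ∈ 𝓤₂} ∩ fibreEventB ends 𝒲 t (A₂ ∩ B₂) ∩
      avoidAllB ends 𝒲 t Y) := prob_nonneg hp _
  have nR₁ : 0 ≤ expect p (fun ω => 𝓤₁.indicator (1 : Set V → R) (clusterB ends ω 𝒲 t) *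
      delEventProb p ends B₁ (clusterB ends ω 𝒲 t) *
      delEventProb p ends A₁ (clusterB ends ω 𝒲 t) * (avoidAllB ends 𝒲 t X).indicator 1 ω) :=
    expect_nonneg hp fun ω => mul_nonneg (mul_nonneg (mul_nonneg (nI _ _)
      (delEventProb_nonneg p hp ends B₁ _)) (delEventProb_nonneg p hp ends A₁ _)) (nA _ ω)
  have nM : 0 ≤ expect p (fun ω => delEventProb p ends A₁ (clusterB ends ω 𝒲 t) *
      delEventProb p ends A₂ (clusterB ends ω 𝒲 t) * (avoidAllB ends 𝒲 t (X ∪ Y)).indicator 1 ω) :=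
    expect_nonneg hp fun ω => mul_nonneg (mul_nonneg (delEventProb_nonneg p hp ends A₁ _)
      (delEventProb_nonneg p hp ends A₂ _)) (nA _ ω)
  have nJ : 0 ≤ prob p ({ω | clusterB ends ω 𝒲 t ∈ 𝓤₁ ∩ 𝓤₂} ∩ fibreEventB ends 𝒲 t (B₁ ∩ B₂) ∩
      avoidAllB ends 𝒲 t (X ∩ Y)) := prob_nonneg hp _
  calc prob p ({ω | clusterB ends ω 𝒲 t ∈ 𝓤₁} ∩ fibreEventB ends 𝒲 t (A₁ ∩ B₁) ∩
          avoidAllB ends 𝒲 t X) *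
        prob p ({ω | clusterB ends ω 𝒲 t ∈ 𝓤₂} ∩ fibreEventB ends 𝒲 t (A₂ ∩ B₂) ∩
          avoidAllB ends 𝒲 t Y)
      ≤ expect p (fun ω => 𝓤₁.indicator (1 : Set V → R) (clusterB ends ω 𝒲 t) *
            delEventProb p ends B₁ (clusterB ends ω 𝒲 t) *
            delEventProb p ends A₁ (clusterB ends ω 𝒲 t) * (avoidAllB ends 𝒲 t X).indicator 1 ω) *
          expect p (fun ω => 𝓤₂.indicator (1 : Set V → R) (clusterB ends ω 𝒲 t) *
            delEventProb p ends B₂ (clusterB ends ω 𝒲 t) *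
            delEventProb p ends A₂ (clusterB ends ω 𝒲 t) * (avoidAllB ends 𝒲 t Y).indicator 1 ω) :=
        mul_le_mul eL₁ eL₂ nL₂ nR₁
    _ ≤ expect p (fun ω => 𝓤₁.indicator (1 : Set V → R) (clusterB ends ω 𝒲 t) *
            delEventProb p ends B₁ (clusterB ends ω 𝒲 t) *
            (𝓤₂.indicator (1 : Set V → R) (clusterB ends ω 𝒲 t) *
              delEventProb p ends B₂ (clusterB ends ω 𝒲 t)) *
            (avoidAllB ends 𝒲 t (X ∩ Y)).indicator 1 ω) *
          expect p (fun ω => delEventProb p ends A₁ (clusterB ends ω 𝒲 t) *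
            delEventProb p ends A₂ (clusterB ends ω 𝒲 t) *
            (avoidAllB ends 𝒲 t (X ∪ Y)).indicator 1 ω) := key
    _ ≤ prob p ({ω | clusterB ends ω 𝒲 t ∈ 𝓤₁ ∩ 𝓤₂} ∩ fibreEventB ends 𝒲 t (B₁ ∩ B₂) ∩
          avoidAllB ends 𝒲 t (X ∩ Y)) *
        prob p (fibreEventB ends 𝒲 t (A₁ ∩ A₂) ∩ avoidAllB ends 𝒲 t (X ∪ Y)) :=
        mul_le_mul eJ eM nM nJ

end Four

end BlockFamily

end Summit.Ventures.PercRepro2
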